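import Summits.BirchSwinnertonDyer.Rank1Residual.X11b.LocalPrimaryCohomologyEP
import Summits.BirchSwinnertonDyer.Rank1Residual.Additive.KummerVersusUnramifiedLocal
import Summits.BirchSwinnertonDyer.Rank1Residual.Additive.TamagawaLocalTorsion
import Literature.NumberTheory.EllipticCurves.KummerSelmerStructure
import HarnessLib

/-!
# The `E[p]` instance of the N2 parity law, PART VI: Tate's local counts
# `#H¹(K_v, E[p]) = (#𝓛_v)²` (every finite `v`) and `#H¹(K_v, E[p]) = (#H¹_ur)²` (every finite `v ∤ p`)
# — the binders `hcard` of `X10/ResidualSelmerLocalDuality.hX_groupForm` and `hcardΛ` of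
# `X10/ResidualSelmerUnramifiedDuality.hΛ_groupForm`, BOTH discharged
# (cell `b2b-bsdres`, unit `b2b-bsdres-x10` = N2 class lead, GEN 31; theorems only, no definition, no
# named fact, nothing booked — COUNT-1 and COUNT-2 of `class-closure/N2/P-INSTANCE-ASK-x10g31.md` §4)

HONEST FRAMING (run/shared/lean/b2b/bsd-rank1-residual/, verbatim in every file): the goal of the
cell is to DELETE the COMBINATION-SHAPED residual classes of the Birch–Swinnerton-Dyer formula for
ALL analytic-rank `≤ 1` elliptic curves over `ℚ` — "full BSD formula for every rank `≤ 1` curve in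
class `C`" assembled STRICTLY from published theorems — so that the rank-`≤ 1` remainder becomes
exactly the CONSTRUCTION-SHAPED classes, which are TYPED (missing-input `Prop`s), NOT attempted.
This is not "finishing BSD". Class X10b (= N2) keeps its label CONSTRUCTION-SHAPED (NEEDS `X_A3`,
referee R82.3 / RESIDUAL-MAP §I N2); this file is a TOOL; no mark / label / tier / count moves.

## What

Klagsbrun–Mazur–Rubin 2013 Lemma 5.3 / Thm. 3.1 and Mazur–Rubin 2007 Prop. 2.1 ("Tate's local duality
shows that `𝓔` is self-dual") need, besides isotropy, the two COUNTS `#𝓛_v · #𝓛_v = #H¹(K_v, E[p])`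
(the Kummer condition is maximal isotropic) and `#H¹_ur · #H¹_ur = #H¹(K_v, E[p])` at `v ∤ p` (so is the
unramified condition; Milne *ADT* I Thm. 2.6 with Lemma 2.9, for ANY finite module, ramified or not).
Every factor is ALREADY a theorem of the tree, with no hypothesis on the reduction type:
Tate's local Euler characteristic `#H¹(K_v, E[n]) = (#E(K_v)[n] · #(𝓞_v/n))²` (sub-cell X11b,
`natCard_galoisCohomology_one_torsion_adicCompletion_eq_sqEP`, Milne I Thm. 2.8 DISCHARGED), Milne I
Lemma 3.3 `#𝓛_v = #E(K_v)[n] · #(𝓞_v/n)` (`natCard_kummerLocalConditionAt_adicCompletion`),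
`#(𝓞_v/p) = 1` for `v ∤ p` (`Additive.natCard_quotient_span_natCast_eq_one`) and team n1011's GENERAL
unramified count `#H¹_ur(K_v, E[p]) = #E(K_v)[p]` (`natCard_unramifiedSubgroup_torsion_eq_natCard_ker_nsmul`,
Milne I 2.9). Hence, fact-free:

* §1 `natCard_galoisCohomology_eq_natCard_kummer_sq` — `#H¹(K_v, E[p]) = #𝓛_v · #𝓛_v` at every
  finite `v` (any prime `p`, any reduction type; `𝓛_v = W.kummerSelmerStructure p (Sum.inr v)`), and
  `hcard_groupForm` — the binder `hcard` of `ResidualSelmerLocalDuality.hX_groupForm` for every finite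
  set of places `S`;
* §2 `natCard_galoisCohomology_eq_natCard_unramified_sq` — `#H¹(K_v, E[p]) = #H¹_ur · #H¹_ur` at
  every finite `v ∤ p` (good, multiplicative or additive; `E[p]` ramified at `v` or not), and
  `hcardΛ_groupForm` — the binder `hcardΛ` of `ResidualSelmerUnramifiedDuality.hΛ_groupForm_of_forall`
  for every finite set of places `S₀` containing the places above `p`.

With these, no COUNT and no unramifiedness input of the ASK remains.

## References

* [MilneADT2006] J. S. Milne, *Arithmetic Duality Theorems*, I Thm. 2.6, Thm. 2.8, Lemma 2.9,
  Lemma 3.3, Cor. 3.4.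
* [KlagsbrunMazurRubin2013] Thm. 3.1, Lemma 5.3; [MazurRubin2007] Prop. 2.1; [Rubin2011] Prop. 1.4.13 (1).
* HOME/class-closure/N2/P-INSTANCE-ASK-x10g31.md §4 (COUNT-1, COUNT-2); HOME/X10-AUDIT.md §37.8.
-/

set_option autoImplicit false

noncomputable section

open scoped Classical

open WeierstrassCurve Literature.NumberTheory.EllipticCurves Literature.NumberTheory.GaloisRepresentations
  NumberField IsDedekindDomain
open Literature.NumberTheory.GaloisRepresentations.DiscreteGaloisModule (unramifiedSubgroup)
open Summit.BirchSwinnertonDyer.Rank1Residual.X11b.LocBridge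

namespace Summit.BirchSwinnertonDyer.Rank1Residual.X10.ResidualSelmerLocalCounts

variable {K : Type} [Field K] [NumberField K] (W : WeierstrassCurve K) [W.IsElliptic] (p : ℕ)
  [hp : Fact p.Prime]

/-! ### §1. `#H¹(K_v, E[p]) = (#𝓛_v)²` at every finite place — `hcard` -/

/-- **Tate's count: `#H¹(K_v, E[p]) = #𝓛_v · #𝓛_v`** at every finite place `v` (`𝓛_v` the local Kummer
condition): Milne I Thm. 2.8 (X11b's discharged local Euler characteristic) with Lemma 3.3.
[cite: MilneADT2006, Ch. I, Thm. 2.8 and Lemma 3.3] -/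
theorem natCard_galoisCohomology_eq_natCard_kummer_sq (v : HeightOneSpectrum (𝓞 K)) :
    Nat.card (galoisCohomology ((W.torsionGaloisModule (p : ℤ)).toLocal (Sum.inr v)) 1) =
      Nat.card (W.kummerSelmerStructure (p : ℤ) (Sum.inr v)) *
        Nat.card (W.kummerSelmerStructure (p : ℤ) (Sum.inr v)) := by
  haveI : NeZero p := ⟨hp.out.ne_zero⟩
  have h1 := natCard_galoisCohomology_one_torsion_adicCompletion_eq_sqEP W v p hp.out.isPrimePow
  have h2 := W.natCard_kummerLocalConditionAt_adicCompletion v (n := p) hp.out.ne_zero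
  change Nat.card (galoisCohomology (GaloisRep.restrictField (v.adicCompletion K)
    (W.torsionGaloisModule (p : ℤ))) 1) = Nat.card (W.kummerLocalConditionAt (p : ℤ) (v.adicCompletion K)) *
      Nat.card (W.kummerLocalConditionAt (p : ℤ) (v.adicCompletion K))
  rw [h1, h2, sq]

/-- **`hcard` — the count binder of `ResidualSelmerLocalDuality.hX_groupForm`, discharged** for every
finite set of places `S` (indeed at every finite place). [cite: MilneADT2006, Ch. I, Thm. 2.8 and Lemma 3.3] -/
theorem hcard_groupForm (S : Finset (Place K)) :
    ∀ v : HeightOneSpectrum (𝓞 K), (Sum.inr v : Place K) ∈ S →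
      Nat.card (galoisCohomology ((W.torsionGaloisModule (p : ℤ)).toLocal (Sum.inr v)) 1) ≤
        Nat.card (W.kummerSelmerStructure (p : ℤ) (Sum.inr v)) *
          Nat.card (W.kummerSelmerStructure (p : ℤ) (Sum.inr v)) :=
  fun v _ => (natCard_galoisCohomology_eq_natCard_kummer_sq W p v).le

/-! ### §2. `#H¹(K_v, E[p]) = (#H¹_ur)²` at every finite `v ∤ p` — `hcardΛ` -/

/-- **`#H¹(K_v, E[p]) = #H¹_ur(K_v, E[p]) · #H¹_ur(K_v, E[p])` at every finite `v ∤ p`** (any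
reduction type; Milne I Thm. 2.6 / 2.8 with Lemma 2.9, from X11b's discharged local Euler
characteristic and n1011's general `#H¹_ur = #E(K_v)[p]`).
[cite: MilneADT2006, Ch. I, Thm. 2.6, Thm. 2.8 and Lemma 2.9] -/
theorem natCard_galoisCohomology_eq_natCard_unramified_sq {v : HeightOneSpectrum (𝓞 K)}
    (hpv : ((p : ℕ) : 𝓞 K) ∉ v.asIdeal) :
    Nat.card (galoisCohomology ((W.torsionGaloisModule (p : ℤ)).toLocal (Sum.inr v)) 1) =
      Nat.card (unramifiedSubgroup (GaloisRep.toLocal v (W.torsionGaloisModule (p : ℤ))) 1) *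
        Nat.card (unramifiedSubgroup (GaloisRep.toLocal v (W.torsionGaloisModule (p : ℤ))) 1) := by
  haveI : NeZero p := ⟨hp.out.ne_zero⟩
  -- `#H¹ = (#E(K_v)[p] · #(𝓞_v/p))² = #E(K_v)[p]²`
  have h1 := natCard_galoisCohomology_one_torsion_adicCompletion_eq_sqEP W v p hp.out.isPrimePow
  rw [Summit.BirchSwinnertonDyer.Rank1Residual.Additive.natCard_quotient_span_natCast_eq_one p v hpv,
    mul_one] at h1
  -- `#H¹_ur = #E(K_v)[p]` (any finite module: Milne I 2.9)
  have h2 := W.natCard_unramifiedSubgroup_torsion_eq_natCard_ker_nsmul v (p := p)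
  change Nat.card (galoisCohomology (GaloisRep.restrictField (v.adicCompletion K)
    (W.torsionGaloisModule (p : ℤ))) 1) =
    Nat.card (unramifiedSubgroup ((W.torsionGaloisModule (p : ℤ)).restrictField (v.adicCompletion K)) 1) *
      Nat.card (unramifiedSubgroup ((W.torsionGaloisModule (p : ℤ)).restrictField (v.adicCompletion K)) 1)
  rw [h1, h2, sq]

/-- **`hcardΛ` at one finite `v ∤ p`** — the count binder of `ResidualSelmerUnramifiedDuality.hΛ_groupForm`,
as the inequality `#H¹(K_v, E[p]) ≤ #H¹_ur · #H¹_ur`. [cite: MilneADT2006, Ch. I, Thm. 2.6 and Lemma 2.9] -/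
theorem hcardΛ_of_not_mem {v : HeightOneSpectrum (𝓞 K)} (hpv : ((p : ℕ) : 𝓞 K) ∉ v.asIdeal) :
    Nat.card (galoisCohomology ((W.torsionGaloisModule (p : ℤ)).toLocal (Sum.inr v)) 1) ≤
      Nat.card (unramifiedSubgroup (GaloisRep.toLocal v (W.torsionGaloisModule (p : ℤ))) 1) *
        Nat.card (unramifiedSubgroup (GaloisRep.toLocal v (W.torsionGaloisModule (p : ℤ))) 1) :=
  (natCard_galoisCohomology_eq_natCard_unramified_sq W p hpv).le

/-- **`hcardΛ` for the law, discharged.** For every finite set of places `S₀` containing the places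
above `p`: `#H¹(K_v, E[p]) ≤ #H¹_ur · #H¹_ur` at every finite `v ∉ S₀` — the binder `hcardΛ` of
`ResidualSelmerUnramifiedDuality.hΛ_groupForm_of_forall`, for every reduction type at those places.
[cite: MilneADT2006, Ch. I, Thm. 2.6 and Lemma 2.9] -/
theorem hcardΛ_groupForm {S₀ : Finset (Place K)}
    (hSp : ∀ v : HeightOneSpectrum (𝓞 K), ((p : ℕ) : 𝓞 K) ∈ v.asIdeal → (Sum.inr v : Place K) ∈ S₀) :
    ∀ v : HeightOneSpectrum (𝓞 K), (Sum.inr v : Place K) ∉ S₀ →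
      Nat.card (galoisCohomology ((W.torsionGaloisModule (p : ℤ)).toLocal (Sum.inr v)) 1) ≤
        Nat.card (unramifiedSubgroup (GaloisRep.toLocal v (W.torsionGaloisModule (p : ℤ))) 1) *
          Nat.card (unramifiedSubgroup (GaloisRep.toLocal v (W.torsionGaloisModule (p : ℤ))) 1) :=
  fun v hv => hcardΛ_of_not_mem W p fun h => hv (hSp v h)

end Summit.BirchSwinnertonDyer.Rank1Residual.X10.ResidualSelmerLocalCounts

end
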